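import Summits.BirchSwinnertonDyer.BirchSwinnertonDyer.Theorems.SchneiderFreeAdditiveX3AnomalousTwistIndexInputs
import Summits.BirchSwinnertonDyer.BirchSwinnertonDyer.Theorems.SchneiderFreeAdditiveX3AnomalousTwistIndexPlumbing
import Summits.BirchSwinnertonDyer.BirchSwinnertonDyer.Theorems.EisensteinPrimesAnticyclotomicLocalCdOne
import HarnessLib

/-!
# Route `SchneiderFreeAdditiveX3` (K1 door), crux r3 `GordTwoBranchIMC` (stmt-BirchSwinnertonDyer-19177): **KELLER–YIN'S ANOMALOUS
# λ-INEQUALITY (arXiv:2402.12781 Thm. 1.4.1 (iii), `≤` half, Cases I–III) FOR THE ANOMALOUS `(−3)`-TWIST OF THE K1 DOOR**,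
# `λ(𝔛^{Sf}_nr(θsub)) + λ(𝔛^{Sf}_nr(θquot)) ≤ λ(𝔛^{Sf}(W_K)) + [θquot = 𝟙]`, in the kernel modulo the Greenberg facts and
# `cd_3(G_{K,Σ}) ≤ 2` BY NAME — the «stub_λW» of FINDING-door-c5-g28 §5b, «NOT in print, kernel derivation = bsd-eis A7 transported»

Cell `bsd-schneider-ideate`, seat `bsd-schneider-door-c5` (prover, generation 31; assembly layer; `--supports` 19177, helper).
PARTITION: board row B6 ∩ X3 ∩ sst-twist, `r = 1` — the 1 725 ANOMALOUS pairs of the (G-ord, `e = 2`) half at `p = 3` (of 2 411; census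
kit j319291 / j323864).  bears_on: K1-door (items 18971/18972 retired → 19177 r3).  FILE 6 of the port of cell `bsd-eis`'s V21 INDEX ROAD
(x1 LEAD g4 `imprimLambdaLE_of_index`, kernel mod PUB for the GOOD anomalous lattice, 2026-08-28; split-multiplicative twin x2-p2 g10
`SplitMultLambdaLE`) to the door's ANOMALOUS TWIN: `W = C • V^{(p*)}`, `p = 3`, `V/ℚ` globally minimal GOOD ORDINARY at `3` with
`3 ∣ a₃(V) − 1` (equivalently — generation 30's `exists_goodOrd_pStar_twist_presentation_of_addv_of_caseOne` + `classX3_and_subGordTwo_iff_caseOne` —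
`W` on the (G-ord, `e = 2`) cell of B6 ∩ X3 at `3` whose good-ordinary `(−3)`-twist models are anomalous).

WHAT IS PROVED (`lambdaInvariant_add_le_of_anomalousTwist`).  For `K` imaginary quadratic with (Heeg) for `N_W` and `3 = v v̄` split, `W(K)[3] = 0`,
`κ` anticyclotomic with topological generator `γ`, `(θsub, θquot)` a residual pair of `W_K[3]` (`IsResidualPairOver`) with `θsub` NON-TRIVIAL on
`D_v̄` (orientation `(ω, 𝟙)` — supplied by Keller–Yin's lattice normalisation «the rational line is `D₃`-non-trivial», arXiv:2410.23241 §3.3, for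
the pair of that line), Fin_v at `v̄` (`hfinED`, the door's CLOSED crux r5 19546), `Sf` = places over `N_W`, any dual data `DSsub`, `DSquot` of
`H¹_{𝓕_nr^{Sf}}(K_∞, (F/𝒪)(θ))`, and the cotorsion clauses («`𝔛^{Sf}(W_K)` f.g. `Λ`-torsion with `μ = 0`» = [INV.μ]/[DIV.tors] of the door,
generation 28's `AnomalousTwistMuZero`; «every dual datum of each character is f.g. torsion `μ = 0`» = [PWL-θ]/[RH] through KY Prop. 1.2.5):
    `λ(DSsub.X) + λ(DSquot.X) ≤ λ(𝔛^{Sf}(W_K)) + [θquot = 𝟙]`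
GRANTED BY NAME the PUBLISHED facts Greenberg 2016 Prop. 2.6.3 (`prop263_sur_of_crk`), Greenberg 2006 Props. 4.1, 4.2, §5 A, 3.2 and
`cd_3(G_{K,Σ}) ≤ 2` (NSW (8.3.18), `groupCdLE_two_galoisGroupUnramifiedOutside K`).  The «+1» is Keller–Yin's: `[θquot = 𝟙]` = «`φ|_{G_K} = ω`»
in their labelling — GENERIC on this cell (1 488 of the 1 725 pairs have `W[3]^{ss} = 𝟙 ⊕ ω`, FINDING-door-c5-g28 §2c).
PROOF = x1's road run on FILES 1–5: the ∃-package (FILE 5) → `cd_3(ker κ ⊓ D_v̄) ≤ 1` local divisibility / surjectivity (x1-w4's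
`AnticyclotomicLocalCdOne`, reduction-free) → the MID-LEVEL composition `ResidualIndexAssembly.zpCorank_datumStrictSelmer_add_eq` (x1 LEAD g4) →
plumbing (FILE 4, with the orientation upgrade «`θsub` ramified at `v̄`» DERIVED).

HONEST FRAMING: composition theorem CONDITIONAL BY NAME on six published facts typed as `Prop`s (not proved in the tree); the cotorsion clauses are
HYPOTHESES (their door suppliers are generation 28's files, themselves conditional on [RH]/[PWL-θ]); nothing analytic (no `𝓛`, no congruence, no main
conjecture) is touched; no registered stub of 19177's skeleton v10b is closed (all six are named facts); no item closed; BSD proved for no curve;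
«closes rung: none».  References: Keller–Yin arXiv:2402.12781v2 Thm. 1.4.1 (iii), §1.3–§1.4 [KellerYin2024]; [Greenberg2016Selmer] Prop. 2.6.3;
[Greenberg2006] Props. 3.2, 4.1, 4.2, §5 A; [NeukirchSchmidtWingberg2008] (8.3.18); [GreenbergLNM1716] §1, §4; x1 halves `imprimLambdaLE_of_index`,
x2 `SplitMultLambdaLE` (templates).
-/

set_option autoImplicit false
-- the route's Theorems namespace repeats the summit name by design (D-0017 nested layout)
set_option linter.dupNamespace false

noncomputable section

open scoped Classical

namespace Summit.BirchSwinnertonDyer.BirchSwinnertonDyer.Theorems.SchneiderFreeAdditiveX3.AnomalousTwistLambdaLE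

open PowerSeries WeierstrassCurve NumberField IsDedekindDomain Field
  Literature.NumberTheory.GaloisRepresentations Literature.NumberTheory.EllipticCurves.GreenbergVatsal2000
  Literature.NumberTheory.EllipticCurves Literature.NumberTheory.EllipticCurves.Rank1Residual
  Literature.NumberTheory.EllipticCurves.Castella2018 Literature.NumberTheory.EllipticCurves.GreenbergSelmer
  Literature.NumberTheory.QuadraticFields Literature.NumberTheory.EllipticCurves.KellerYin2024
  Literature.NumberTheory.EllipticCurves.IwasawaAlgebra Literature.NumberTheory.IwasawaTheory
  Literature.NumberTheory.IwasawaTheory.Greenberg2016 Literature.NumberTheory.IwasawaTheory.Greenberg2006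
  Literature.NumberTheory.GaloisCohomology
  Summit.BirchSwinnertonDyer.Rank1Residual.X2.ResidualDevissageModules
  Summit.BirchSwinnertonDyer.BirchSwinnertonDyer.Theorems
  Summit.BirchSwinnertonDyer.BirchSwinnertonDyer.Theorems.SchneiderFreeAdditiveX3

/-- **Keller–Yin's anomalous `λ`-inequality (Thm. 1.4.1 (iii), `≤` half) FOR THE ANOMALOUS `(−3)`-TWIST OF THE K1 DOOR, orientation `(ω, 𝟙)`,
in the kernel modulo the Greenberg facts and `cd_3(G_{K,Σ}) ≤ 2` BY NAME**: see the module docstring for the binders; conclusion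
`λ(DSsub.X) + λ(DSquot.X) ≤ λ(𝔛^{Sf}(W_K)) + [θquot = 𝟙]`. The x1 V21 index road (∃-package → `cd_p ≤ 1` local inputs → mid-level composition →
plumbing) run on FILES 1–5. [cite: KellerYin2024, Thm. 1.4.1 (iii) and §1.3–§1.4 Cases I–III (arXiv:2402.12781v2 TeX L1087–1330)]
[cite: Greenberg2016Selmer, Prop. 2.6.3] [cite: Greenberg2006, Props. 3.2, 4.1, 4.2, §5 A] [cite: NeukirchSchmidtWingberg2008, (8.3.18)]
[cite: GreenbergLNM1716, §1 p. 62, §4 p. 109] -/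
theorem lambdaInvariant_add_le_of_anomalousTwist {V : WeierstrassCurve ℚ} [V.IsElliptic] [V.IsGloballyMinimal]
    (h263 : prop263_sur_of_crk) (h41 : prop41_globalEulerPoincareCorank)
    (h42 : prop42_localEulerPoincareCorank) (h5A : sec5A_localH2_subsingleton_of_LOC1)
    (h32 : prop32_cohomology_isCofinitelyGenerated)
    (W : WeierstrassCurve ℚ) [W.IsElliptic] [W.IsGloballyMinimal] (p : ℕ) [Fact p.Prime]
    (hp3 : p = 3) (hV : GoodOrd V p) (ha : (p : ℤ) ∣ V.frobeniusTrace p - 1)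
    (C : VariableChange ℚ) (hC : C • V.quadraticTwist ((-1 : ℚ) ^ (p / 2) * p) = W)
    (K : Type) [Field K] [NumberField K] (hK : IsImaginaryQuadratic K)
    (hCD2 : groupCdLE_two_galoisGroupUnramifiedOutside K)
    (hH : SatisfiesHeegnerHypothesis (W.conductorNorm ℤ) K)
    (htor : ∀ Q : (W.baseChange K).toAffine.Point, p • Q = 0 → Q = 0)
    (ι : K →+* ℚ_[p]) (v vbar : HeightOneSpectrum (𝓞 K))
    (hv : ∀ x : 𝓞 K, x ∈ v.asIdeal ↔ ‖ι (x : K)‖ < 1)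
    (hvbar : ((p : ℕ) : 𝓞 K) ∈ vbar.asIdeal) (hne : vbar ≠ v)
    (κ : ZpExtension K p) (hκ : κ.IsAnticyclotomic)
    (γ : absoluteGaloisGroup K) [Fact (κ.IsTopGenerator γ)]
    (θsub θquot : FramedGaloisRep K (padicCoeffIntegers (∅ : Set (PadicAlgCl p))) 1)
    (hpair : IsResidualPairOver (W.baseChange K) p θsub θquot)
    (hram : ∃ τ ∈ decomp vbar, unitChar θsub τ ≠ 1)
    (hfinED : Finite {x : ↥((W.baseChange K).geomPrimaryTorsion p) // ∀ g : ↥(κ.kerSubgroup ⊓ decomp vbar), g • x = x})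
    (Sf : Finset (HeightOneSpectrum (𝓞 K)))
    (hSf : ∀ w : HeightOneSpectrum (𝓞 K), w ∈ Sf ↔ ((W.conductorNorm ℤ : ℤ) : 𝓞 K) ∈ w.asIdeal)
    (DSsub : DatumDualData κ γ (charModule ∅ θsub)
        (AcSelmer.bdpData (charModule ∅ θsub) p vbar) (↑Sf : Set (HeightOneSpectrum (𝓞 K))))
    (DSquot : DatumDualData κ γ (charModule ∅ θquot)
        (AcSelmer.bdpData (charModule ∅ θquot) p vbar) (↑Sf : Set (HeightOneSpectrum (𝓞 K))))
    (hfgS : Module.Finite (IwasawaAlgebra p) (AcSelmer.XAc (W.baseChange K) p κ vbar (↑Sf : Set (HeightOneSpectrum (𝓞 K))) γ))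
    (htorS : Module.IsTorsion (IwasawaAlgebra p) (AcSelmer.XAc (W.baseChange K) p κ vbar (↑Sf : Set (HeightOneSpectrum (𝓞 K))) γ))
    (hμS : muInvariant p (AcSelmer.XAc (W.baseChange K) p κ vbar (↑Sf : Set (HeightOneSpectrum (𝓞 K))) γ) = 0)
    (hSsub : ∀ D : DatumDualData κ γ (charModule ∅ θsub)
        (AcSelmer.bdpData (charModule ∅ θsub) p vbar) (↑Sf : Set (HeightOneSpectrum (𝓞 K))),
      Module.Finite (IwasawaAlgebra p) D.X ∧ Module.IsTorsion (IwasawaAlgebra p) D.X ∧ muInvariant p D.X = 0)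
    (hSquot : ∀ D : DatumDualData κ γ (charModule ∅ θquot)
        (AcSelmer.bdpData (charModule ∅ θquot) p vbar) (↑Sf : Set (HeightOneSpectrum (𝓞 K))),
      Module.Finite (IwasawaAlgebra p) D.X ∧ Module.IsTorsion (IwasawaAlgebra p) D.X ∧ muInvariant p D.X = 0) :
    lambdaInvariant p DSsub.X + lambdaInvariant p DSquot.X ≤
      lambdaInvariant p (AcSelmer.XAc (W.baseChange K) p κ vbar (↑Sf : Set (HeightOneSpectrum (𝓞 K))) γ) +
        (if ∀ σ : absoluteGaloisGroup K, θquot σ = 1 then 1 else 0) := by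
  have hp : 2 < p := by omega
  have hpvK : ((p : ℕ) : 𝓞 K) ∈ v.asIdeal := IndexPlumbingNrVsStrict.natCast_mem_asIdeal_of_forall_norm_iff hv
  -- the ∃-package of inputs for the anomalous twist
  obtain ⟨c, τ, Φ, j₁, j₃, hj₁, hj₃, hτ, hdist, hreps₁, hreps₂, hreps₃, hj₁inj, hj₃inj, hr₁, hr₃, hr₂, hd₂, hUi, hU₁, hU₂,
    hU₃, hsur₁, hsur₂, hsur₃, hprim₁, hprim₂, hprim₃, hfin₁, hfin₂, hfin₃, hinv₁, hinv₂, hinv₃, hN₂, hfinq, hε, hN₁D,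
    htrivD, hfinQ, hN₃, hinvD₁, hinvD₃, hH2⟩ :=
    AnomalousTwistIndexInputs.indexInputs_anomalousTwist h263 h41 h42 h5A h32 W p hp hp3 hV ha C hC K hK hCD2 hH htor ι v vbar hv
      hvbar hne κ hκ γ θsub θquot hpair hram hfinED Sf hSf hfgS htorS hμS hSsub hSquot
  haveI := hfin₁; haveI := hfin₂; haveI := hfin₃; haveI := hfinq; haveI := hfinQ
  haveI hEK : (W.baseChange K).IsElliptic := inferInstanceAs (W.map (algebraMap ℚ K)).IsElliptic
  have hcN₂ : ∀ b : ↥((W.baseChange K).geomTorsion (p : ℤ)), Continuous fun σ : absoluteGaloisGroup K ↦ σ • b :=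
    fun b ↦ continuous_of_injective_comp (G := absoluteGaloisGroup K) Subtype.val_injective
      ((W.baseChange K).continuous_smul_geomPoints (b : geomPoints (W.baseChange K)))
  -- DIV ×3 and LRS: `cd_p(ker κ ⊓ D_v̄) ≤ 1` (x1-p1-w4 gen 3, `AnticyclotomicLocalCdOne`)
  have hneD : ∃ τ ∈ decomp (K := K) vbar, κ τ ≠ 1 :=
    AnticyclotomicLocalCdOne.exists_mem_decomp_apply_ne_one_of_isAnticyclotomic κ vbar hK hp.ne' hκ hvbar
  have hdiv₁ : ∀ y : subgroupH1 (κ.kerSubgroup ⊓ decomp vbar) (charModule ∅ θsub), ∃ y', p • y' = y := fun y ↦ by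
    obtain ⟨y', hy'⟩ := AnticyclotomicLocalCdOne.exists_eq_nsmul_subgroupH1_inf_decomp κ vbar hneD
      (CharResidualSelmerCount.continuous_smul_charModule θsub) (CharResidualSelmerCount.charModule_divisible θsub) y
    exact ⟨y', hy'.symm⟩
  have hdiv₂ : ∀ y : subgroupH1 (κ.kerSubgroup ⊓ decomp vbar) ↥((W.baseChange K).geomPrimaryTorsion p),
      ∃ y', p • y' = y := fun y ↦ by
    obtain ⟨y', hy'⟩ := AnticyclotomicLocalCdOne.exists_eq_nsmul_subgroupH1_inf_decomp κ vbar hneD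
      ((W.baseChange K).continuous_smul_geomPrimaryTorsion p) hd₂ y
    exact ⟨y', hy'.symm⟩
  have hdiv₃ : ∀ y : subgroupH1 (κ.kerSubgroup ⊓ decomp vbar) (charModule ∅ θquot), ∃ y', p • y' = y := fun y ↦ by
    obtain ⟨y', hy'⟩ := AnticyclotomicLocalCdOne.exists_eq_nsmul_subgroupH1_inf_decomp κ vbar hneD
      (CharResidualSelmerCount.continuous_smul_charModule θquot) (CharResidualSelmerCount.charModule_divisible θquot) y
    exact ⟨y', hy'.symm⟩
  have hpQ : ∀ Q : ↥((W.baseChange K).geomTorsion (p : ℤ)), p • Q = 0 := fun Q ↦ by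
    apply Subtype.ext
    have h := (mem_geomTorsion_iff (W.baseChange K) (p : ℤ) (Q : geomPoints (W.baseChange K))).mp Q.2
    rw [AddSubmonoidClass.coe_nsmul, ← natCast_zsmul, h]
    rfl
  have hlrs := AnticyclotomicLocalCdOne.resH1Hom_id_surjective_inf_decomp κ vbar hneD
    (fun a ↦ Φ.continuous_smul_sub hcN₂ a) hcN₂ (fun a ↦ Φ.continuous_smul_quot hcN₂ a)
    (fun n ↦ ⟨1, Φ.incl_injective (by rw [map_nsmul, map_zero, pow_one]; exact hpQ _)⟩)
    Φ.incl Φ.incl_smul Φ.incl_injective Φ.proj Φ.proj_smul Φ.proj_incl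
    (fun b hb ↦ Φ.mem_range_incl_of_proj_eq_zero b hb) Φ.proj_surjective
  -- FIN: `W(K_{∞,v̄})[3^∞]` finite — carried (the door's closed crux r5 `LocalTowerTorsionFiniteX3`)
  haveI := hfinED
  -- the MID-LEVEL identity (LEAD x1-p1 g4's composition, fed the package)
  have hmid := ResidualIndexAssembly.zpCorank_datumStrictSelmer_add_eq κ.kerSubgroup p
    (↑Sf : Set (HeightOneSpectrum (𝓞 K))) vbar hvbar Φ.incl Φ.proj Φ.incl_smul Φ.proj_smul Φ.incl_injective
    Φ.proj_surjective (fun b hb ↦ Φ.mem_range_incl_of_proj_eq_zero b hb) Φ.proj_incl j₁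
    (AddSubgroup.inclusion (geomTorsion_le_geomPrimaryTorsion (W.baseChange K) p)) j₃ hj₁ (fun _ _ ↦ rfl) hj₃ hj₁inj
    (AddSubgroup.inclusion_injective _) hj₃inj hr₁ hr₂ hr₃ (CharResidualSelmerCount.charModule_divisible θsub) hd₂
    (CharResidualSelmerCount.charModule_divisible θquot) (fun a ↦ Φ.continuous_smul_sub hcN₂ a) hcN₂
    (fun a ↦ Φ.continuous_smul_quot hcN₂ a) (CharResidualSelmerCount.continuous_smul_charModule θsub)
    ((W.baseChange K).continuous_smul_geomPrimaryTorsion p) (CharResidualSelmerCount.continuous_smul_charModule θquot)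
    hUi hU₁ hU₂ hU₃ c τ hreps₁ hreps₂ hreps₃ hsur₁ hsur₂ hsur₃ hdiv₁ hdiv₂ hdiv₃ hlrs hprim₁ hprim₂ hprim₃ hinv₁ hinv₂ hinv₃
    hN₂ hε hN₁D htrivD hN₃ hinvD₁ hinvD₃ hH2
  haveI := hfgS
  exact AnomalousTwistIndexPlumbing.lambdaInvariant_add_le_of_mid_anomalousTwist W p hp3 hV ha C hC K hK vbar hpvK hvbar hne κ hκ γ
    θsub θquot hpair hram Sf hSf DSsub DSquot c τ hreps₃ hmid htorS hμS hSsub hSquot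

end Summit.BirchSwinnertonDyer.BirchSwinnertonDyer.Theorems.SchneiderFreeAdditiveX3.AnomalousTwistLambdaLE

end
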